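import Summits.BirchSwinnertonDyer.BirchSwinnertonDyer.Theorems.EisensteinPrimesGoodLatticeBDPValueOfNamedFacts
import Summits.BirchSwinnertonDyer.BirchSwinnertonDyer.Theorems.EisensteinPrimesGoodLatticeBDPValuePublishedFactsOfTextbook
import Literature.NumberTheory.GaloisCohomology.RestrictedRamificationCdTwoOfPoitouTateReal
import HarnessLib
/-!
# Crux 2 `GoodLatticeBDPValue` (stmt-BirchSwinnertonDyer-19032), line `halves` v22: stub 4c `stub_publishedFactCD2`
# (`cd_p(G_{L,S}) ≤ 2` for EVERY number field `L`, NSW (8.3.18) / Harari Cor. 17.14) FROM the textbook fact Harari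
# Thm. 17.13 (a), and the crux BY NAME with that input discharged

Cell `bsd-eis` (run/shared/lean/pub/bsd-eis/), width seat `bsd-line-x1-p1-w7` gen 2 (FILL-TO-CAP width copy of `-w2`; director's
item (2) INPUTS→UNCONDITIONAL), `--supports stmt-BirchSwinnertonDyer-19032`. After v22 (sha256 873a80a3…) the registered line
`halves` has no kernel stub: crux 2 ⇐ {20 PUBLISHED named facts in four bundles} ∧ 3a-A, gate-checked as the LEAD's conditional
theorem `GoodLatticeBDPValueOfNamedFacts.goodLatticeBDPValue_of_namedFacts` (p660812). One of the twenty is stub 4c,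
`∀ L, GaloisCohomology.groupCdLE_two_galoisGroupUnramifiedOutside L` (Harari Cor. 17.14 = NSW (8.3.18), quantified over EVERY
number field). The Literature proof file `RestrictedRamificationCdTwoOfPoitouTateReal.lean` (this seat) proves that corollary
from Harari Thm. 17.13 (a) `GaloisCohomology.poitouTate_restricted_three_le` for every number field — real places included (at an
odd `p` the absolute Galois group of a real completion has order `2`, prime to `p`, hence `p`-cohomological dimension `0`) —
extending the tree's totally complex case used by `-w2` gen 6 at the imaginary quadratic field
(`GoodLatticeBDPValuePublishedFactsOfTextbook.groupCdLE_two_of_poitouTate_of_isImaginaryQuadratic`).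

Results (sorry-free; no definition, no new named fact):

* §1 `publishedFactCD2_of_poitouTate` — the registered statement of `stub_publishedFactCD2` (token for token) from the ONE
  textbook hypothesis `∀ L, poitouTate_restricted_three_le L`;
* §2 `goodLatticeBDPValue_of_namedFacts_of_poitouTate` — the crux BY NAME from stubs 1, 3a-A, 4, 4b (hypotheses, verbatim) and
  `∀ L, poitouTate_restricted_three_le L` in place of stub 4c (the LEAD's p660812 ∘ §1);
* §3 `goodLatticeBDPValue_of_namedFacts_of_textbook` — the crux BY NAME from stubs 1, 3a-A, 4b (verbatim) and, in place of
  stubs 4 and 4c, the five hypotheses of `-w2` gen 6's `publishedFactsGreenberg_of_textbook` (Greenberg 2016 Prop. 4.1.1,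
  BCGKPST 2020 §3.3, weak Leopoldt T4, Tate's global Euler–Poincaré characteristic, Harari Thm. 17.13 (a)) — i.e. crux 2 ⇐
  {7 + 4 + 3 research named facts, 2 TEXTBOOK named facts} ∧ 3a-A: 16 named facts instead of 20, with `cd_p ≤ 2` gone at every
  number field (not only at `K`).

HONEST FRAMING: input bookkeeping / conditional theorems only; closes no registered stub by itself (stub 4c stays a named-fact
stub unless a LEAD re-registers it with the Poitou–Tate antecedent or deletes it); no summit statement / BSD / KY Thm. 2.2.2 /
the crux is proved here; 0 cells / labels move.

References: [Harari2020] Thm. 17.13 (a), Cor. 17.14; [NeukirchSchmidtWingberg2008] (8.3.18); [SerreGaloisCohomology1997] I §3.1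
Prop. 11, I §3.3 Cor. 2; [MilneADT2006] I Thm. 4.10 (c), Cor. 4.15, Thm. 5.1; [Greenberg2006] Props. 3.2, 4.1; [Greenberg2016Selmer]
Prop. 4.1.1; [BleherEtAl2020] §3.3; [KellerYin2024] Thm. 3.0.8.
-/

-- D-0017: single-problem summit, the namespace repeats the problem name by design.
set_option linter.dupNamespace false
set_option autoImplicit false

noncomputable section

open scoped Classical

open PowerSeries WeierstrassCurve NumberField IsDedekindDomain Field
  Literature.NumberTheory.GaloisRepresentations Literature.NumberTheory.EllipticCurves.GreenbergVatsal2000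
  Summit.BirchSwinnertonDyer.BirchSwinnertonDyer.Theorems.EisensteinPrimesMuLambda
  Literature.NumberTheory.EllipticCurves Literature.NumberTheory.EllipticCurves.ModularForms
  Literature.NumberTheory.EllipticCurves.Rank1Residual Literature.NumberTheory.EllipticCurves.Castella2018
  Literature.NumberTheory.EllipticCurves.GreenbergSelmer Literature.NumberTheory.QuadraticFields
  Literature.NumberTheory.EllipticCurves.CastellaGrossiLeeSkinner2022
  Literature.NumberTheory.EllipticCurves.KellerYin2024 Literature.NumberTheory.EllipticCurves.IwasawaAlgebra
  Literature.NumberTheory.EllipticCurves.Rubin1991 Literature.NumberTheory.EllipticCurves.DeShalit1987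
  Literature.NumberTheory.EllipticCurves.Hida2010MuInvariant Literature.NumberTheory.EllipticCurves.BCGKPST2020
open Literature.NumberTheory.IwasawaTheory Literature.NumberTheory.IwasawaTheory.Greenberg2016
  Literature.NumberTheory.IwasawaTheory.Greenberg2006
open Summit.BirchSwinnertonDyer.Rank1Residual.X1.KellerYinHalves
  Summit.BirchSwinnertonDyer.Rank1Residual.X2.ResidualDevissageModules
  Summit.BirchSwinnertonDyer.Rank1Residual.X1.KellerYinMuLambdaSplitDSFree
  Summit.BirchSwinnertonDyer.BirchSwinnertonDyer.Theorems
  Summit.BirchSwinnertonDyer.BirchSwinnertonDyer.Theorems.GoodLatticeBDPValueHalves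
  Summit.BirchSwinnertonDyer.BirchSwinnertonDyer.Theorems.GoodLatticeBDPValueOfImprimitive
  Summit.BirchSwinnertonDyer.BirchSwinnertonDyer.Theorems.GoodLatticeBDPValueOfOneInequality
  Summit.BirchSwinnertonDyer.BirchSwinnertonDyer.Theorems.GoodLatticeImprimitiveOfQuotient
  Summit.BirchSwinnertonDyer.BirchSwinnertonDyer.Theorems.GoodLatticeQuotientOfCorank
  Summit.BirchSwinnertonDyer.BirchSwinnertonDyer.Theorems.GoodLatticeCorankOfGe
open Literature.NumberTheory.GaloisCohomology
open Summit.BirchSwinnertonDyer.BirchSwinnertonDyer.Theorems.GoodLatticeBDPValueOfNamedFacts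
  Summit.BirchSwinnertonDyer.BirchSwinnertonDyer.Theorems.GoodLatticeBDPValuePublishedFactsOfTextbook

namespace Summit.BirchSwinnertonDyer.BirchSwinnertonDyer.Theorems.GoodLatticeBDPValuePublishedFactCD2OfPoitouTate

/-! ### §1. Stub 4c `stub_publishedFactCD2` from Harari Thm. 17.13 (a), every number field -/

/-- **The registered statement of `stub_publishedFactCD2` (halves v20.2–v22, token for token) from ONE textbook hypothesis**:
Poitou–Tate in degrees `≥ 3` for every number field (`ha`, Harari Thm. 17.13 (a)) gives `cd_p(G_{L,S}) ≤ 2` for every number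
field `L`, every prime `p` (`≠ 2` if `L` has a real place) and every `S ∋ v ∣ p` (Harari Cor. 17.14 / NSW (8.3.18)) — the
Literature theorem `forall_groupCdLE_two_galoisGroupUnramifiedOutside_of_poitouTate_three_le`.
[cite: Harari2020, Thm. 17.13 (a), Cor. 17.14 (p. 295)] [cite: NeukirchSchmidtWingberg2008, (8.3.18)] -/
theorem publishedFactCD2_of_poitouTate
    (ha : ∀ (L : Type) [Field L] [NumberField L], poitouTate_restricted_three_le L) :
    ∀ (L : Type) [Field L] [NumberField L],
      Literature.NumberTheory.GaloisCohomology.groupCdLE_two_galoisGroupUnramifiedOutside L :=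
  forall_groupCdLE_two_galoisGroupUnramifiedOutside_of_poitouTate_three_le ha

/-! ### §2–§3. The crux BY NAME with stub 4c (and stub 4's Greenberg conjuncts) discharged to textbook facts -/

section

variable (stub_publishedFacts :
    castellaHsieh2018_exists_isBDPLFunction ∧
      (∀ (N : ℕ) [NeZero N], IsNewformOf.level_eq_conductorNorm (N := N)) ∧
      proofThm422_exists_isBDPLFunction_isTorsion_charIdeal_dvd ∧
      thm513_exists_isBDPLFunction_valueAtOne ∧
      thm331_rubin_exists_katzMeasure₂_pseudoIso_span_eq ∧
      thmII64_katzMeasure₂_functionalEquation ∧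
      thmI_mu_katzBranch_reflect_eq_zero)
  (stub_anacongOfFullDescentDatum :
  ∀ (W : WeierstrassCurve ℚ) [W.IsElliptic] [W.IsGloballyMinimal] (p : ℕ) [Fact p.Prime],
    2 < p → Good W p → Red W p → Anom W p →
    ((∃ (ℓ : ℕ) (hℓ : ℓ.Prime), haveI : Fact ℓ.Prime := ⟨hℓ⟩; Addv W ℓ) ∨
      (∃ (ℓ : ℕ) (hℓ : ℓ.Prime), haveI : Fact ℓ.Prime := ⟨hℓ⟩;
        W.HasMultiplicativeReductionAtPrime ℓ ∧
          ((W.HasSplitMultiplicativeReductionAtPrime ℓ ∧ ℓ ≡ 1 [MOD p]) ∨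
            (¬ W.HasSplitMultiplicativeReductionAtPrime ℓ ∧ ℓ + 1 ≡ 0 [MOD p])))) →
    (∀ Φ : AddSubgroup (geomTorsion W (p : ℤ)), IsRationalLine W p Φ → ¬ LineUnramifiedAt W p Φ) →
    ∀ (K : Type) [Field K] [NumberField K], IsImaginaryQuadratic K →
      SatisfiesHeegnerHypothesis (W.conductorNorm ℤ) K → SatisfiesHeegnerHypothesis p K →
      Odd (NumberField.discr K) → NumberField.discr K ≠ -3 →
      (∀ Q : (W.baseChange K).toAffine.Point, p • Q = 0 → Q = 0) →
    ∀ (ι : K →+* ℚ_[p]) (v vbar : HeightOneSpectrum (𝓞 K)),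
      (∀ x : 𝓞 K, x ∈ v.asIdeal ↔ ‖ι (x : K)‖ < 1) →
      ((p : ℕ) : 𝓞 K) ∈ vbar.asIdeal → vbar ≠ v →
    ∀ (κ : ZpExtension K p), κ.IsAnticyclotomic →
    ∀ (γ : absoluteGaloisGroup K) [Fact (κ.IsTopGenerator γ)],
    ∀ (N : ℕ) [NeZero N] (Dt : ModularParametrizationData W N),
    ∀ (ι' : PadicAlgCl p ≃+* ℂ),
      (∀ (w : InfinitePlace K) (k : 𝓞 K), k ∈ v.asIdeal ↔ ‖ι'.symm (w.embedding (k : K))‖ < 1) →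
    ∀ (ΩK : ℂ) (Ωp : (unrIntegers p)ˣ) (L : UnrSeries p), ΩK ≠ 0 →
      IsBDPLFunction ι' v κ γ Dt.f ΩK ((Ωp : unrIntegers p) : ℂ_[p]) L →
    ∀ (θsub θquot : FramedGaloisRep K (padicCoeffIntegers (∅ : Set (PadicAlgCl p))) 1),
      IsResidualPairOver (W.baseChange K) p θsub θquot →
    ∀ (Sf : Finset (HeightOneSpectrum (𝓞 K))),
      (∀ w : HeightOneSpectrum (𝓞 K), w ∈ Sf ↔ ((W.conductorNorm ℤ : ℤ) : 𝓞 K) ∈ w.asIdeal) →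
    ∀ (θK : HeckeCharacter K), IsHeckeCharOf ι' θquot θK →
    ∀ (Cbar : Finset (HeightOneSpectrum (𝓞 K))), (∀ u ∈ Cbar, ¬ θK.IsUnramifiedAt u) →
    ∀ (ΩK' : ℂ) (Ωp' : (unrIntegers p)ˣ) (Lφ : UnrSeries p), ΩK' ≠ 0 →
      IsKatzLFunction ι' v vbar Cbar κ γ θK ΩK' ((Ωp' : unrIntegers p) : ℂ_[p]) Lφ →
    ∃ n nφ : ℕ, FirstUnitCoeffAt L n ∧ FirstUnitCoeffAt Lφ nφ ∧
      n + ∑ w ∈ Sf, curveLocalLambda κ (W.baseChange K) w =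
        2 * nφ + ∑ w ∈ Sf, (charLocalLambda ∅ κ θsub w + charLocalLambda ∅ κ θquot w))
  (stub_publishedFactsGreenberg :
    prop411_selmer_isAlmostDivisible ∧ prop422_localCohomology_isAlmostDivisible ∧
      sec5A_localH2_subsingleton_of_LOC1 ∧ prop41_globalEulerPoincareCorank ∧
      prop42_localEulerPoincareCorank ∧ prop32_cohomology_isCofinitelyGenerated ∧
      BCGKPST2020.sec33_rubin_unrSelmer₂_finite_torsion ∧
      weakLeopoldt_H2_subsingleton_above_cyclotomic_of_isOpen)
  (stub_publishedFactsMore :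
    prop263_sur_of_crk ∧ thm222_anacong_goodLattice_of_five_le ∧ thm222_anacong_goodLattice_of_ne_one ∧
      thm212_exists_isKatzLFunction)

include stub_publishedFacts stub_anacongOfFullDescentDatum stub_publishedFactsGreenberg stub_publishedFactsMore in
/-- **Crux 2 BY NAME from stubs 1, 3a-A, 4, 4b and Harari Thm. 17.13 (a) in place of stub 4c** (the LEAD's
`goodLatticeBDPValue_of_namedFacts`, p660812, with its fifth hypothesis supplied by §1).
[cite: KellerYin2024, Thm. 3.0.8 (IMC2)] [cite: Harari2020, Thm. 17.13 (a), Cor. 17.14] -/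
theorem goodLatticeBDPValue_of_namedFacts_of_poitouTate
    (ha : ∀ (L : Type) [Field L] [NumberField L], poitouTate_restricted_three_le L) :
    Summit.BirchSwinnertonDyer.BirchSwinnertonDyer.Theses.EisensteinPrimes.GoodLatticeBDPValue :=
  goodLatticeBDPValue_of_namedFacts stub_publishedFacts stub_anacongOfFullDescentDatum stub_publishedFactsGreenberg
    stub_publishedFactsMore (publishedFactCD2_of_poitouTate ha)

include stub_publishedFacts stub_anacongOfFullDescentDatum stub_publishedFactsMore in
/-- **Crux 2 BY NAME from stubs 1, 3a-A, 4b and — in place of stubs 4 and 4c — Greenberg 2016 Prop. 4.1.1, BCGKPST 2020 §3.3,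
weak Leopoldt (T4), Tate's global Euler–Poincaré characteristic and Harari Thm. 17.13 (a)** (the LEAD's p660812 ∘ `-w2` gen 6's
`publishedFactsGreenberg_of_textbook` ∘ §1): sixteen named facts (two of them textbook) and 3a-A.
[cite: KellerYin2024, Thm. 3.0.8 (IMC2)] [cite: Greenberg2016Selmer, Prop. 4.1.1] [cite: BleherEtAl2020, §3.3 Thm. 3.3.1]
[cite: NguyenQuangDo1984, Thm. 2.2] [cite: MilneADT2006, I Thm. 5.1] [cite: Harari2020, Thm. 17.13 (a)] -/
theorem goodLatticeBDPValue_of_namedFacts_of_textbook (h411 : prop411_selmer_isAlmostDivisible)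
    (hT : ∀ (K : Type) [Field K] [NumberField K], tateGlobalEulerPoincareCharacteristic K)
    (ha : ∀ (K : Type) [Field K] [NumberField K], poitouTate_restricted_three_le K)
    (h33 : BCGKPST2020.sec33_rubin_unrSelmer₂_finite_torsion)
    (hT4 : weakLeopoldt_H2_subsingleton_above_cyclotomic_of_isOpen) :
    Summit.BirchSwinnertonDyer.BirchSwinnertonDyer.Theses.EisensteinPrimes.GoodLatticeBDPValue :=
  goodLatticeBDPValue_of_namedFacts stub_publishedFacts stub_anacongOfFullDescentDatum
    (publishedFactsGreenberg_of_textbook h411 hT ha h33 hT4) stub_publishedFactsMore (publishedFactCD2_of_poitouTate ha)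

end

end Summit.BirchSwinnertonDyer.BirchSwinnertonDyer.Theorems.GoodLatticeBDPValuePublishedFactCD2OfPoitouTate

end
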